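import Summits.Ventures.LatticeQCDFlow.Scaling.CompositionProductBracket

/-!
HONEST FRAMING: exact (Metropolis-corrected) sampling algorithms for lattice gauge theory; figures
of merit are autocorrelation/cost numbers at stated couplings and volumes; no continuum-physics
claim.

# CompositionProductBracketSigned — THE PRODUCT BRACKET FOR A COUPLING WITH PENALTY PAIRS: `E_π[Δ'(Φ+e−r_a−r_b)] ≤ Δ(Φ+e−R_X−R_Y) − (Φ+e−2r_max)·D⁺ + (Φ+e−2r_min)·D⁻`,
# `D⁺ = E_π(Δ−Δ')⁺`, `D⁻ = E_π(Δ'−Δ)⁺`, FOR WEIGHTS `r_min ≤ r ≤ r_max` (lean-2 GEN-43, ours)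

Venture-side (OURS).  Cell `lqcd-flow` (pub-lqcd), unit `pub-lqcd-lean-2-g43`, 2026-08-31.  Chapter AC, file 7 — a tool for the C2 ∕ C4 assembly.  Chapter V file 5
(`product_bracket_le`) bounds the product potential after one cycle for ANY coupling `π` of the two end-hub laws by `(Δ − G_π)(Φ+e) − Δ(R_X+R_Y) + 2r_max·D⁺`, using `r ≥ 0` on
the pairs where the distance GROWS (`Δ' > Δ`).  At the cycle level such pairs do not occur (the optimal coupling is monotone under domination, W22); at the per-attempt-count level
they do: the `j`-attempt laws dominate each other only off the start content (Z4), and the start-content deficit `(y_j(z) − x_j(z))⁺` that is not absorbed by the tag's occupation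
and the gap at `a` must be paired with surplus at another ordinary content — a pair at distance `Δ + 1` (memo MEMO-gen43 §3).  With a LOWER bound `r_min` on the weights (for the
hub weights `θ ∈ [½,1]`: `r_min = ½`) the growth pairs are charged `Φ + e − 2r_min` instead of `Φ + e`:

* §1 `product_bracket_signed_le`: `E_π[Δ'(Φ+e−r_a−r_b)] ≤ (Φ+e)·E_πΔ' − Δ(R_X+R_Y) + 2r_max·D⁺ − 2r_min·D⁻`;
  **`product_bracket_signed`**: `E_π[Δ'(Φ+e−r_a−r_b)] ≤ Δ(Φ+e−R_X−R_Y) − (Φ+e−2r_max)·D⁺ + (Φ+e−2r_min)·D⁻` (`E_πΔ' = Δ − D⁺ + D⁻` when `π` has total mass `1`);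
* §2 **`product_contract_signed`**: if `ρΔΦ ≤ (Φ+e−2r_max)D⁺ − (Φ+e−2r_min)D⁻ + Δ(R_X+R_Y−e)` then `E_π[Δ'Φ'] ≤ (1−ρ)ΔΦ`.

With `r = θ`, `r_max = 1`, `r_min = ½`, `Δ = 1` and the net gain `G = D⁺ − D⁻`: the bound is `Φ + e − R_X − R_Y − (Φ+e−2)G + D⁻` — the penalty pairs cost ONE unit of potential
per unit mass beyond the net-gain accounting.  Literature grade (cell rule): OWN, elementary; nothing cited; no new bib keys.
-/

open Finset

namespace Summit.Ventures.LatticeQCDFlow.Scaling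

section ProductSigned
variable {S : Type*} [Fintype S]

/-! ## §1 The bracket with growth pairs -/

/-- Pointwise: `(Δ − Δ')·r ≤ r_max·(Δ−Δ')⁺ − r_min·(Δ'−Δ)⁺` for `r_min ≤ r ≤ r_max`. [ours] -/
theorem product_signed_pointwise {x r rmin rmax : ℝ} (hrmin : rmin ≤ r) (hrmax : r ≤ rmax) :
    x * r ≤ rmax * max x 0 - rmin * max (-x) 0 := by
  rcases le_total 0 x with h | h
  · rw [max_eq_left h, max_eq_right (by linarith : -x ≤ 0), mul_zero, sub_zero, mul_comm]
    exact mul_le_mul_of_nonneg_right hrmax h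
  · rw [max_eq_right h, max_eq_left (by linarith : 0 ≤ -x), mul_zero, zero_sub]
    nlinarith

/-- **The product bracket with growth pairs, first form:** `E_π[Δ'(Φ+e−r_a−r_b)] ≤ (Φ+e)·E_πΔ' − Δ(R_X+R_Y) + 2r_max·D⁺ − 2r_min·D⁻`. [ours] -/
theorem product_bracket_signed_le (π Dn : S → S → ℝ) (uX uY r : S → ℝ) (D Φ e rmin rmax : ℝ)
    (hπ0 : ∀ a b, 0 ≤ π a b) (hrow : ∀ a, ∑ b, π a b = uX a) (hcol : ∀ b, ∑ a, π a b = uY b)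
    (hrmin : ∀ v, rmin ≤ r v) (hrmax : ∀ v, r v ≤ rmax) :
    ∑ a, ∑ b, π a b * (Dn a b * (Φ + e - r a - r b))
      ≤ (Φ + e) * (∑ a, ∑ b, π a b * Dn a b) - D * (∑ a, uX a * r a + ∑ b, uY b * r b)
        + 2 * rmax * (∑ a, ∑ b, π a b * max (D - Dn a b) 0) - 2 * rmin * (∑ a, ∑ b, π a b * max (Dn a b - D) 0) := by
  rw [prod_next_mass_sum]
  -- `Σ π Δ' r_a ≥ D·R_X − r_max·D⁺ + r_min·D⁻`, and the same for `r_b`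
  have hside : ∀ (s : S → S → ℝ), (∀ a b, rmin ≤ s a b) → (∀ a b, s a b ≤ rmax) →
      ∑ a, ∑ b, π a b * D * s a b - rmax * (∑ a, ∑ b, π a b * max (D - Dn a b) 0) + rmin * (∑ a, ∑ b, π a b * max (Dn a b - D) 0)
        ≤ ∑ a, ∑ b, π a b * Dn a b * s a b := by
    intro s hsmin hsmax
    rw [mul_sum, mul_sum, ← sum_sub_distrib, ← sum_add_distrib]
    refine sum_le_sum fun a _ => ?_
    rw [mul_sum, mul_sum, ← sum_sub_distrib, ← sum_add_distrib]
    refine sum_le_sum fun b _ => ?_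
    have hπ := hπ0 a b
    have hm := product_signed_pointwise (x := D - Dn a b) (hsmin a b) (hsmax a b)
    have e : max (-(D - Dn a b)) 0 = max (Dn a b - D) 0 := by rw [neg_sub]
    rw [e] at hm
    have := mul_le_mul_of_nonneg_left hm hπ
    nlinarith [this]
  have hA := hside (fun a _ => r a) (fun a _ => hrmin a) (fun a _ => hrmax a)
  have hB := hside (fun _ b => r b) (fun _ b => hrmin b) (fun _ b => hrmax b)
  have h1 : ∑ a, ∑ b, π a b * D * r a = D * ∑ a, uX a * r a := by
    rw [mul_sum]
    refine sum_congr rfl fun a _ => ?_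
    rw [← hrow a, sum_mul, mul_sum]
    exact sum_congr rfl fun b _ => by ring
  have h2 : ∑ a, ∑ b, π a b * D * r b = D * ∑ b, uY b * r b := by
    rw [mul_sum, sum_comm]
    refine sum_congr rfl fun b _ => ?_
    rw [← hcol b, sum_mul, mul_sum]
    exact sum_congr rfl fun a _ => by ring
  rw [h1] at hA
  rw [h2] at hB
  linarith

/-- `E_πΔ' = Δ − D⁺ + D⁻` for a coupling of total mass `1`. [ours] -/
theorem product_signed_mass (π Dn : S → S → ℝ) (uX : S → ℝ) (D : ℝ) (hrow : ∀ a, ∑ b, π a b = uX a) (htot : ∑ a, uX a = 1) :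
    ∑ a, ∑ b, π a b * Dn a b = D - (∑ a, ∑ b, π a b * max (D - Dn a b) 0) + (∑ a, ∑ b, π a b * max (Dn a b - D) 0) := by
  have hpt : ∀ a b, π a b * Dn a b = π a b * D - π a b * max (D - Dn a b) 0 + π a b * max (Dn a b - D) 0 := by
    intro a b
    rcases le_total 0 (D - Dn a b) with h | h
    · rw [max_eq_left h, max_eq_right (by linarith : Dn a b - D ≤ 0)]; ring
    · rw [max_eq_right h, max_eq_left (by linarith : 0 ≤ Dn a b - D)]; ring
  have hmass : ∑ a, ∑ b, π a b * D = D := by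
    rw [show ∑ a, ∑ b, π a b * D = (∑ a, ∑ b, π a b) * D by rw [sum_mul]; exact sum_congr rfl fun a _ => by rw [sum_mul]]
    simp_rw [hrow]; rw [htot, one_mul]
  calc ∑ a, ∑ b, π a b * Dn a b = ∑ a, ∑ b, (π a b * D - π a b * max (D - Dn a b) 0 + π a b * max (Dn a b - D) 0) :=
        sum_congr rfl fun a _ => sum_congr rfl fun b _ => hpt a b
    _ = (∑ a, ∑ b, π a b * D) - (∑ a, ∑ b, π a b * max (D - Dn a b) 0) + (∑ a, ∑ b, π a b * max (Dn a b - D) 0) := by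
        simp_rw [sum_add_distrib, sum_sub_distrib]
    _ = _ := by rw [hmass]

/-- **THE PRODUCT BRACKET WITH GROWTH PAIRS:** `E_π[Δ'(Φ+e−r_a−r_b)] ≤ Δ(Φ+e−R_X−R_Y) − (Φ+e−2r_max)·D⁺ + (Φ+e−2r_min)·D⁻`. [ours] -/
theorem product_bracket_signed (π Dn : S → S → ℝ) (uX uY r : S → ℝ) (D Φ e rmin rmax : ℝ)
    (hπ0 : ∀ a b, 0 ≤ π a b) (hrow : ∀ a, ∑ b, π a b = uX a) (hcol : ∀ b, ∑ a, π a b = uY b) (htot : ∑ a, uX a = 1)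
    (hrmin : ∀ v, rmin ≤ r v) (hrmax : ∀ v, r v ≤ rmax) :
    ∑ a, ∑ b, π a b * (Dn a b * (Φ + e - r a - r b))
      ≤ D * (Φ + e - ∑ a, uX a * r a - ∑ b, uY b * r b)
        - (Φ + e - 2 * rmax) * (∑ a, ∑ b, π a b * max (D - Dn a b) 0) + (Φ + e - 2 * rmin) * (∑ a, ∑ b, π a b * max (Dn a b - D) 0) := by
  have h := product_bracket_signed_le π Dn uX uY r D Φ e rmin rmax hπ0 hrow hcol hrmin hrmax
  rw [product_signed_mass π Dn uX D hrow htot] at h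
  linarith

/-! ## §2 The contraction criterion -/

/-- **CONTRACTION CRITERION WITH GROWTH PAIRS:** if `ρΔΦ ≤ (Φ+e−2r_max)·D⁺ − (Φ+e−2r_min)·D⁻ + Δ(R_X+R_Y−e)` then `E_π[Δ'Φ'] ≤ (1−ρ)ΔΦ`. [ours] -/
theorem product_contract_signed (π Dn : S → S → ℝ) (uX uY r : S → ℝ) (D Φ e rmin rmax ρ : ℝ)
    (hπ0 : ∀ a b, 0 ≤ π a b) (hrow : ∀ a, ∑ b, π a b = uX a) (hcol : ∀ b, ∑ a, π a b = uY b) (htot : ∑ a, uX a = 1)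
    (hrmin : ∀ v, rmin ≤ r v) (hrmax : ∀ v, r v ≤ rmax)
    (hcrit : ρ * D * Φ ≤ (Φ + e - 2 * rmax) * (∑ a, ∑ b, π a b * max (D - Dn a b) 0)
        - (Φ + e - 2 * rmin) * (∑ a, ∑ b, π a b * max (Dn a b - D) 0) + D * (∑ a, uX a * r a + ∑ b, uY b * r b - e)) :
    ∑ a, ∑ b, π a b * (Dn a b * (Φ + e - r a - r b)) ≤ (1 - ρ) * D * Φ := by
  have h := product_bracket_signed π Dn uX uY r D Φ e rmin rmax hπ0 hrow hcol htot hrmin hrmax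
  linarith

end ProductSigned

end Summit.Ventures.LatticeQCDFlow.Scaling
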